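/-
Copyright (c) 2026. All rights reserved.
Released under Apache 2.0 license as described in the file LICENSE.
Authors: HodgeCM publication cell (pub-hodgecm), GR lane, third hand (`pub-hodgecm-own-crow`).
-/
import Literature.NumberTheory.Automorphic.AdelicPiSchwartzBruhatPlancherel
import HarnessLib

/-!
# The embedding `𝒮(𝔸_K^ι) → L²(𝔸_K^ι, ν)` as a linear map

Topic `NumberTheory/Automorphic`; namespace `Literature.NumberTheory.Automorphic`.  KERNEL ONLY: one definition with body
(`piSchwartzBruhatToLp`) and proved theorems; no named fact, no `sorry`.  The adelic twin of
`SchwartzBruhatL2Dense.SchwartzBruhat.toLp` (one finite place).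

[Weil1964, Chap. I n° 11] works with the unitary metaplectic operators on `L²(X)` and the dense invariant subspace of
standard (Schwartz–Bruhat) functions; [GelbartRogawski1991, §3.1 p. 454 L21–27] phrase `Mp_𝐀(W)` on the Hilbert space
of `ρ_ψ`.  The tree's adelic objects live on the SMOOTH model `𝒮(𝔸_K^ι) = piSchwartzBruhat K ι` (a submodule of the
functions `𝔸_K^ι → ℂ`); the abstract passage to a Hilbert completion (`Weil1964/AdelicMetaplecticUnitaryLeg`,
`RepresentationTheory/Unitary/ScaledIsometryExtension`) is stated for a linear map `i : 𝒮(𝔸_K^ι) →ₗ[ℂ] H`.  This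
file provides THE `i` of the `L²(𝔸_K^ι, ν)` model, for every additive Haar measure `ν`:

* §1 **`piSchwartzBruhatToLp K ι ν : piSchwartzBruhat K ι →ₗ[ℂ] Lp ℂ 2 ν`**, `Φ ↦ [Φ]`
  (`𝒮 ⊆ L²`: `memLp_two_of_mem_piSchwartzBruhat_of_isAddHaarMeasure` of `AdelicPiSchwartzBruhatPlancherel`);
  `piSchwartzBruhatToLp_apply` / `piSchwartzBruhatToLp_eq_toLp` (it is `MemLp.toLp` for ANY proof of square
  integrability — so statements written with another `MemLp` witness rewrite into it), `coeFn_piSchwartzBruhatToLp`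
  (`[Φ] = Φ` a.e.);
* §2 the norm: **`norm_piSchwartzBruhatToLp_sq`** `‖[Φ]‖² = (∫⁻ ‖Φ‖ₑ² dν).toReal` (the hypothesis shape
  `‖i Φ‖ ^ 2 = (∫⁻ x, ‖Φ x‖ₑ ^ 2 ∂ν).toReal` under which `Weil1964/AdelicMetaplecticL2ScaledIsometries` supplies the
  scaled-isometry property of every metaplectic operator), `enorm_piSchwartzBruhatToLp_sq`, and injectivity
  `piSchwartzBruhatToLp_injective` (a non-zero Schwartz–Bruhat function is continuous, Haar measures charge open sets);
* §3 the range: **`range_piSchwartzBruhatToLp`** `= {f | ∃ Φ ∈ 𝒮, f = Φ a.e.}` — so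
  `denseRange_piSchwartzBruhatToLp_iff` turns a density statement in the latter form (the GR-1 lane's
  `Weil1964.dense_piSchwartzBruhat`) into `DenseRange (piSchwartzBruhatToLp K ι ν)`, the hypothesis `hd` of
  `Weil1964.adelicMpCont.unitaryLeg`;
* §4 Plancherel restated: `norm_piSchwartzBruhatToLp_adelicPiFourier` — `‖[Φ̂]‖ = ν(D^ι) ‖[Φ]‖`.

## References
* [Weil1964] A. Weil, Acta Math. 111 (1964) 143–211, Chap. I n° 11, n° 13.
* [GelbartRogawski1991] S. Gelbart, J. Rogawski, Invent. Math. 105 (1991), §3.1 p. 454 L21–27.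
* [CasselsFrohlichANT1967] J. Tate, in Cassels–Fröhlich (eds.), *Algebraic Number Theory* (1967), Ch. XV, Thm. 4.1.2.
-/

set_option autoImplicit false

noncomputable section

open MeasureTheory MeasureTheory.Measure NumberField IsDedekindDomain
open scoped ENNReal NNReal

namespace Literature.NumberTheory.Automorphic

variable (K : Type) [Field K] [NumberField K] (ι : Type) [Fintype ι]
  [MeasurableSpace (AdeleRing (𝓞 K) K)] [BorelSpace (AdeleRing (𝓞 K) K)]
  (ν : Measure (ι → AdeleRing (𝓞 K) K)) [ν.IsAddHaarMeasure]

/-! ## §1 The embedding -/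

/-- **the embedding `𝒮(𝔸_K^ι) → L²(𝔸_K^ι, ν)`, `Φ ↦ [Φ]`**, as a `ℂ`-linear map (every Schwartz–Bruhat function is
square integrable for every additive Haar measure). [cite: Weil1964, Chap. I n° 11] -/
def piSchwartzBruhatToLp : piSchwartzBruhat K ι →ₗ[ℂ] Lp ℂ 2 ν where
  toFun Φ := (memLp_two_of_mem_piSchwartzBruhat_of_isAddHaarMeasure ν Φ.2).toLp (Φ : (ι → AdeleRing (𝓞 K) K) → ℂ)
  map_add' Φ Ψ := by
    rw [← MemLp.toLp_add (memLp_two_of_mem_piSchwartzBruhat_of_isAddHaarMeasure ν Φ.2)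
      (memLp_two_of_mem_piSchwartzBruhat_of_isAddHaarMeasure ν Ψ.2)]
    rfl
  map_smul' c Φ := by
    rw [RingHom.id_apply, ← MemLp.toLp_const_smul c (memLp_two_of_mem_piSchwartzBruhat_of_isAddHaarMeasure ν Φ.2)]
    rfl

variable {K ι}

/-- unfolding. [cite: Weil1964, Chap. I n° 11] -/
theorem piSchwartzBruhatToLp_apply (Φ : piSchwartzBruhat K ι) :
    piSchwartzBruhatToLp K ι ν Φ =
      (memLp_two_of_mem_piSchwartzBruhat_of_isAddHaarMeasure ν Φ.2).toLp (Φ : (ι → AdeleRing (𝓞 K) K) → ℂ) := rfl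

/-- `[Φ]` does not depend on the witness of square integrability: for ANY `hΦ : MemLp Φ 2 ν`,
`piSchwartzBruhatToLp ⟨Φ, _⟩ = hΦ.toLp Φ`. [cite: Weil1964, Chap. I n° 11] -/
theorem piSchwartzBruhatToLp_eq_toLp {Φ : (ι → AdeleRing (𝓞 K) K) → ℂ} (hΦ𝒮 : Φ ∈ piSchwartzBruhat K ι)
    (hΦ : MemLp Φ 2 ν) : piSchwartzBruhatToLp K ι ν ⟨Φ, hΦ𝒮⟩ = hΦ.toLp Φ := rfl

/-- `[Φ] = Φ` almost everywhere. [cite: Weil1964, Chap. I n° 11] -/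
theorem coeFn_piSchwartzBruhatToLp (Φ : piSchwartzBruhat K ι) :
    (piSchwartzBruhatToLp K ι ν Φ : (ι → AdeleRing (𝓞 K) K) → ℂ) =ᵐ[ν] (Φ : (ι → AdeleRing (𝓞 K) K) → ℂ) :=
  MemLp.coeFn_toLp (memLp_two_of_mem_piSchwartzBruhat_of_isAddHaarMeasure ν Φ.2)

/-! ## §2 The norm of `[Φ]` -/

omit [Fintype ι] [BorelSpace (AdeleRing (𝓞 K) K)] [ν.IsAddHaarMeasure] in
/-- `‖Φ‖_{ℒ²(ν)} = (∫⁻ ‖Φ‖ₑ² dν)^{1/2}` for any function. [folklore] -/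
private theorem eLpNorm_two_eq_lintegral_rpow (Φ : (ι → AdeleRing (𝓞 K) K) → ℂ) :
    eLpNorm Φ 2 ν = (∫⁻ x, ‖Φ x‖ₑ ^ 2 ∂ν) ^ (1 / 2 : ℝ) := by
  rw [eLpNorm_eq_lintegral_rpow_enorm_toReal two_ne_zero ENNReal.ofNat_ne_top, ENNReal.toReal_ofNat]
  congr 1
  refine lintegral_congr fun x => ?_
  rw [← ENNReal.rpow_natCast]
  norm_num

/-- `‖[Φ]‖_{L²}` as an extended real: `eLpNorm [Φ] = (∫⁻ ‖Φ‖ₑ² dν)^{1/2}`. [cite: Weil1964, Chap. I n° 11] -/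
theorem eLpNorm_piSchwartzBruhatToLp (Φ : piSchwartzBruhat K ι) :
    eLpNorm (piSchwartzBruhatToLp K ι ν Φ : (ι → AdeleRing (𝓞 K) K) → ℂ) 2 ν =
      (∫⁻ x, ‖(Φ : (ι → AdeleRing (𝓞 K) K) → ℂ) x‖ₑ ^ 2 ∂ν) ^ (1 / 2 : ℝ) := by
  rw [eLpNorm_congr_ae (coeFn_piSchwartzBruhatToLp ν Φ), eLpNorm_two_eq_lintegral_rpow]

/-- **`‖[Φ]‖ₑ² = ∫⁻ ‖Φ‖ₑ² dν`**. [cite: Weil1964, Chap. I n° 11] -/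
theorem enorm_piSchwartzBruhatToLp_sq (Φ : piSchwartzBruhat K ι) :
    ‖piSchwartzBruhatToLp K ι ν Φ‖ₑ ^ 2 = ∫⁻ x, ‖(Φ : (ι → AdeleRing (𝓞 K) K) → ℂ) x‖ₑ ^ 2 ∂ν := by
  rw [Lp.enorm_def, eLpNorm_piSchwartzBruhatToLp, ← ENNReal.rpow_natCast, ← ENNReal.rpow_mul]
  norm_num

/-- **the norm: `‖[Φ]‖² = (∫⁻ ‖Φ‖ₑ² dν).toReal`** — the `L²(ν)`-normed-embedding hypothesis
`‖i Φ‖ ^ 2 = (∫⁻ x, ‖Φ x‖ₑ ^ 2 ∂ν).toReal` of `Weil1964/AdelicMetaplecticL2ScaledIsometries` for `i = piSchwartzBruhatToLp`.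
[cite: Weil1964, Chap. I n° 11] -/
theorem norm_piSchwartzBruhatToLp_sq (Φ : piSchwartzBruhat K ι) :
    ‖piSchwartzBruhatToLp K ι ν Φ‖ ^ 2 = (∫⁻ x, ‖(Φ : (ι → AdeleRing (𝓞 K) K) → ℂ) x‖ₑ ^ 2 ∂ν).toReal := by
  rw [← enorm_piSchwartzBruhatToLp_sq, ← ofReal_norm, ← ENNReal.ofReal_pow (norm_nonneg _),
    ENNReal.toReal_ofReal (pow_nonneg (norm_nonneg _) 2)]

/-- two Schwartz–Bruhat functions with the same `∫⁻ ‖·‖ₑ²` have images of the same norm. [cite: Weil1964, Chap. I n° 13] -/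
theorem norm_piSchwartzBruhatToLp_eq_of_lintegral_eq {Φ Ψ : piSchwartzBruhat K ι}
    (h : ∫⁻ x, ‖(Φ : (ι → AdeleRing (𝓞 K) K) → ℂ) x‖ₑ ^ 2 ∂ν = ∫⁻ x, ‖(Ψ : (ι → AdeleRing (𝓞 K) K) → ℂ) x‖ₑ ^ 2 ∂ν) :
    ‖piSchwartzBruhatToLp K ι ν Φ‖ = ‖piSchwartzBruhatToLp K ι ν Ψ‖ := by
  rw [Lp.norm_def, Lp.norm_def, eLpNorm_piSchwartzBruhatToLp, eLpNorm_piSchwartzBruhatToLp, h]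

/-- a non-zero Schwartz–Bruhat function has `0 < ∫⁻ ‖Φ‖ₑ² dν`: it is continuous and non-zero on a non-empty open
set, which a Haar measure charges. [cite: Weil1964, Chap. I n° 11] -/
theorem piSchwartzBruhat_lintegral_enorm_sq_pos {Φ : (ι → AdeleRing (𝓞 K) K) → ℂ}
    (hΦ : Φ ∈ piSchwartzBruhat K ι) (hΦ0 : Φ ≠ 0) : 0 < ∫⁻ x, ‖Φ x‖ₑ ^ 2 ∂ν := by
  haveI := secondCountableTopology_adeleRing K
  haveI := locallyCompactSpace_adeleRing' K
  haveI := t2Space_adeleRing K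
  haveI : BorelSpace (ι → AdeleRing (𝓞 K) K) := Pi.borelSpace
  have hc : Continuous Φ := continuous_of_mem_piSchwartzBruhat hΦ
  obtain ⟨x₀, hx₀⟩ : ∃ x, Φ x ≠ 0 := by
    by_contra h
    push Not at h
    exact hΦ0 (funext h)
  have hsupp : (Function.support fun x => ‖Φ x‖ₑ ^ 2) = Function.support Φ := by
    ext x
    simp only [Function.mem_support, ne_eq, pow_eq_zero_iff two_ne_zero, enorm_eq_zero]
  have hmeas : Measurable fun x => ‖Φ x‖ₑ ^ 2 := (continuous_enorm.comp hc).measurable.pow_const 2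
  exact (lintegral_pos_iff_support hmeas (μ := ν)).2
    (by rw [hsupp]; exact hc.isOpen_support.measure_pos ν ⟨x₀, hx₀⟩)

/-- **injectivity of `𝒮(𝔸_K^ι) → L²(ν)`**. [cite: Weil1964, Chap. I n° 11] -/
theorem piSchwartzBruhatToLp_injective : Function.Injective (piSchwartzBruhatToLp K ι ν) := by
  intro Φ Ψ h
  have h0 : piSchwartzBruhatToLp K ι ν (Φ - Ψ) = 0 := by rw [map_sub, h, sub_self]
  by_contra hne
  have hne' : ((Φ - Ψ : piSchwartzBruhat K ι) : (ι → AdeleRing (𝓞 K) K) → ℂ) ≠ 0 := by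
    intro h'
    exact hne (sub_eq_zero.1 (Subtype.ext (h'.trans (Submodule.coe_zero).symm)))
  have hpos := piSchwartzBruhat_lintegral_enorm_sq_pos ν (Φ - Ψ).2 hne'
  have : ‖piSchwartzBruhatToLp K ι ν (Φ - Ψ)‖ₑ ^ 2 = 0 := by rw [h0, enorm_zero, zero_pow two_ne_zero]
  rw [enorm_piSchwartzBruhatToLp_sq] at this
  exact hpos.ne' this

/-! ## §3 The range, and density statements -/

/-- **the range of `Φ ↦ [Φ]`** is the set of classes a.e. equal to a Schwartz–Bruhat function. [cite: Weil1964, Chap. I n° 11] -/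
theorem range_piSchwartzBruhatToLp :
    Set.range (piSchwartzBruhatToLp K ι ν) =
      {f : Lp ℂ 2 ν | ∃ Φ ∈ piSchwartzBruhat K ι, (f : (ι → AdeleRing (𝓞 K) K) → ℂ) =ᵐ[ν] Φ} := by
  ext f
  constructor
  · rintro ⟨Φ, rfl⟩
    exact ⟨Φ, Φ.2, coeFn_piSchwartzBruhatToLp ν Φ⟩
  · rintro ⟨Φ, hΦ, hf⟩
    refine ⟨⟨Φ, hΦ⟩, ?_⟩
    rw [piSchwartzBruhatToLp_apply, ← MemLp.toLp_congr (Lp.memLp f) _ hf, Lp.toLp_coeFn]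

/-- **density, in either form**: `Φ ↦ [Φ]` has dense range iff the classes a.e. equal to a Schwartz–Bruhat function
are dense in `L²(ν)` (the form proved in the GR-1 lane, `Weil1964.dense_piSchwartzBruhat`) — the hypothesis `hd` of
`Weil1964.adelicMpCont.unitaryLeg`. [cite: Weil1964, Chap. I n° 11] -/
theorem denseRange_piSchwartzBruhatToLp_iff :
    DenseRange (piSchwartzBruhatToLp K ι ν) ↔
      Dense {f : Lp ℂ 2 ν | ∃ Φ ∈ piSchwartzBruhat K ι, (f : (ι → AdeleRing (𝓞 K) K) → ℂ) =ᵐ[ν] Φ} := by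
  rw [DenseRange, range_piSchwartzBruhatToLp]

/-! ## §4 Plancherel for `[Φ̂]` -/

/-- **PLANCHEREL in `L²(ν)`**: `‖[Φ̂]‖ = ν(D^ι) · ‖[Φ]‖` for `Φ ∈ 𝒮(𝔸_K^ι)` (`= ‖[Φ]‖` for the self-dual measure).
[cite: CasselsFrohlichANT1967, Ch. XV (Tate), Thm. 4.1.2] -/
theorem norm_piSchwartzBruhatToLp_adelicPiFourier (Φ : piSchwartzBruhat K ι) :
    ‖piSchwartzBruhatToLp K ι ν ⟨adelicPiFourier K ι ν Φ, adelicPiFourier_mem_piSchwartzBruhat Φ.2⟩‖ =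
      (ν (piFundamentalDomain K ι)).toReal * ‖piSchwartzBruhatToLp K ι ν Φ‖ := by
  have h := norm_piSchwartzBruhatToLp_sq ν ⟨adelicPiFourier K ι ν Φ, adelicPiFourier_mem_piSchwartzBruhat Φ.2⟩
  have hP : ∫⁻ x, ‖((⟨adelicPiFourier K ι ν Φ, adelicPiFourier_mem_piSchwartzBruhat Φ.2⟩ : piSchwartzBruhat K ι) :
        (ι → AdeleRing (𝓞 K) K) → ℂ) x‖ₑ ^ 2 ∂ν =
      ν (piFundamentalDomain K ι) ^ 2 * ∫⁻ x, ‖(Φ : (ι → AdeleRing (𝓞 K) K) → ℂ) x‖ₑ ^ 2 ∂ν :=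
    lintegral_enorm_sq_adelicPiFourier ν Φ.2
  rw [hP, ENNReal.toReal_mul, ENNReal.toReal_pow, ← norm_piSchwartzBruhatToLp_sq, ← mul_pow] at h
  exact (pow_left_inj₀ (norm_nonneg _) (mul_nonneg ENNReal.toReal_nonneg (norm_nonneg _)) two_ne_zero).1 h

end Literature.NumberTheory.Automorphic

end
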